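import Summits.QuantumFields.YangMills.Theorems.UnitScaleGibbsLinProxySU2Letters
import Summits.QuantumFields.YangMills.Theorems.UnitScaleGibbsActionDerivativeSlotCalculus
import Literature.MathematicalPhysics.QuantumFieldTheory.Balaban1983to89.T4AdjointCovarianceUnitary
import HarnessLib

/-!
# `UnitScaleGibbsTestFieldSU2Dressing` — THE `𝔰𝔲(2)` DRESSING OF A SCALAR TEST FIELD: rows R2∕R5∕R6 of `stub_linTest` (LINE 28 «GrossTransfer»)
# in the skeleton's exact (Frobenius) letters for `u_α b := (u⁰ b : ℂ) • (iσ_α)` (FILE 1 of 2; FILE 2 `…TestFieldSU2DressingPush` reads them in `ℤ^d` currency)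

Cell `ym3-torus` (YM ladder rung R3 = continuum SU(2) Yang–Mills on every three-torus — a RUNG, NOT d = 4, NOT infinite volume, NOT a mass gap, NOT the
Clay problem), crux of record `UnitScaleTilt.HistoryTailL` (stmt-QuantumFields-19936); LINE 28 «GrossTransfer» registered on stmt-QuantumFields-23083
(skeleton v2 `Cruxes/HistoryTailL/Lines/gross_transfer.lean`; v3.2 draft of the pen of record ★w2-19936 g15); width seat `ym-ust-19936-w5` gen 17.

WHY.  The re-lined `stub_linTest` (v3.1∕v3.2, KNIT-PLAN rows R1–R8) asks, for every reference block plaquette, for THREE `M₂(ℂ)`-valued test fields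
`u : Fin 3 → PBond (F.P K) 0 → M₂(ℂ)` on level-`0` torus bonds with the rows
(R2) `∀ α b, star (u α b) = -(u α b) ∧ (u α b).trace = 0`;
(R3) `∀ α b, u α b ≠ 0 → ∃ x, lo + 1 ≤ x ∧ x + e b.dir + 1 ≤ hi ∧ b.src = castSite x ∧ lowPart b.dir (x − lo) ≠ 0`;
(R5) `∀ α, Σ_p ‖u α (slotBond p 0) + u α (slotBond p 1) − u α (slotBond p 2) − u α (slotBond p 3)‖² ≤ C·L^j` (FROBENIUS norm, the skeleton's scope);
(R6) `∀ α, Σ_b ‖u α b‖² ≤ C·L^{cj}`,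
while every supplier of the KNIT works with ONE REAL bond function: the pen's construction is `u_α := u⁰ ⊗ τ_α`, `τ_α = iσ_α`
(✓`UnitScaleGibbsLinProxySU2Letters`, [Balaban1985UV3] p. 260), `u⁰` a real torus bond function (the `castSite` push of a `ℤ³` field, FILE 2; or a
least-squares potential ✓`UnitScaleGibbsBoxLeastSquaresPotential` ∕ ✓`UnitScaleGibbsTorusLeastSquaresPotential`).  THIS FILE is the dressing
dictionary (def-free; `2 × 2` entries):

* §1 PAULI LETTERS IN BOTH NORMS: `star_I_smul_pauli`, `I_smul_pauli_mem_lieSU`, `I_smul_pauli_ne_zero`; for real multiples `star_ofReal_smul_I_smul_pauli`,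
  `trace_ofReal_smul_I_smul_pauli`, `ofReal_smul_I_smul_pauli_mem_lieSU` (so `u_α` can be handed to X-KNIT-L's `Y : PBond → lieSU (Fin 2)`,
  ✓`UnitScaleGibbsActionDerivFlatPairing`), `ofReal_smul_I_smul_pauli_eq_zero_iff`; ★`frobenius_norm_I_smul_pauli : ‖iσ_α‖_F = √2`,
  `frobenius_norm_sq_ofReal_smul_I_smul_pauli : ‖r•iσ_α‖_F² = 2r²`; operator-norm reading `opNorm_ofReal_smul_I_smul_pauli_le : ‖r•iσ_α‖ ≤ 2|r|`
  (X-KNIT-L's `Matrix.Norms.L2Operator` scope, by ✓`norm_I_smul_pauli_le_two`).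
* §2 TORUS ROWS FOR ANY `u⁰ : PBond P j → ℝ`: R2 pointwise (`dress_skew_traceless`, the skeleton's letter verbatim); `ne_zero_of_dress_ne_zero` (ANY support
  row of `u⁰` — FILE 2's push row, GLOBAL-LS's, px22's — transfers to R3's letter unchanged); ★`curl_dress` (the `slotBond` curl of the dressed field is the
  dressed scalar curl); ★★`sum_norm_sq_dress` (R6: `Σ_b ‖u_α b‖_F² = 2·Σ_b (u⁰ b)²`) and ★★`sum_norm_sq_curl_dress` (R5: `Σ_p ‖(du_α)_p‖_F² = 2·Σ_p ((du⁰)_p)²`),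
  EXACT; `re_trace_dress_mul` ∕ `re_trace_curl_dress_mul` ∕ `sum_re_trace_curl_dress_mul` (the flat flux pairing of `du_α` against `X_p` is
  `(du⁰)_p · Re Tr(τ_α X_p)` — the letter of ✓`UnitScaleGibbsLinProxyFluxIdentification.sum_mul_re_trace_eq_re_trace_sum` and of X-KNIT-L's pairing).

HONEST SCOPE.  Finite-dimensional bookkeeping; proves no stub and closes no item.  Nothing of `stub_linTest`, «ShallowFluxSecondMomentL», (Q),
23083∕23133∕23134, K1, `stub_pinnedStep`∕`stub_unitEnvelope` or `HistoryTailL` is proved.  YM₃ on T³ is rung R3 — NOT d = 4, NOT a mass gap, NOT Clay.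
References: T. Bałaban, CMP **102** (1985) 255–275, p. 260 (Pauli matrices as generators of `𝔰𝔲(2)`) [Balaban1985UV3]; CMP **109** (1987) 249–301,
(0.14) p. 254 [Balaban1987RG1]; L. Gross, CMP **92** (1983) 137–162, Thm 2.2 (the flux pairing `⟨du, F⟩`) [GrossCMP1983].
-/

set_option autoImplicit false

noncomputable section

open scoped BigOperators Matrix ComplexConjugate
open Complex Finset
open Literature.MathematicalPhysics.QuantumFieldTheory.Balaban1983to89
open Literature.MathematicalPhysics.QuantumFieldTheory.Balaban1983to89.B10Eq18SigmaSU2 (pauli)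
open Literature.MathematicalPhysics.QuantumFieldTheory.Balaban1983to89.T4AdjointCovarianceUnitary (lieSU mem_lieSU_iff)
open Summit.QuantumFields.YangMills.Theorems.UnitScaleGibbsActionDerivativeSlotCalculus (slotBond)
open Summit.QuantumFields.YangMills.Theorems.UnitScaleGibbsLinProxySU2Letters (conjTranspose_I_smul_pauli trace_I_smul_pauli
  norm_I_smul_pauli_le_two)

namespace Summit.QuantumFields.YangMills.Theorems.UnitScaleGibbsTestFieldSU2Dressing

/-! ## §1 The Pauli letters `τ_α = iσ_α` and their real multiples, in both matrix norms -/

section Pauli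

/-- `τ_α := iσ_α` is skew-Hermitian, in the `star` spelling of the skeleton's row R2. [cite: Balaban1985UV3, p. 260] -/
theorem star_I_smul_pauli (α : Fin 3) : star (I • pauli α) = -(I • pauli α) := by
  rw [Matrix.star_eq_conjTranspose]
  exact conjTranspose_I_smul_pauli α

/-- `τ_α ∈ 𝔰𝔲(2)` (the tree's `lieSU (Fin 2)`: `star X = −X ∧ Tr X = 0`). [cite: Balaban1985UV3, p. 260] -/
theorem I_smul_pauli_mem_lieSU (α : Fin 3) : I • pauli α ∈ lieSU (Fin 2) :=
  mem_lieSU_iff.2 ⟨star_I_smul_pauli α, trace_I_smul_pauli α⟩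

/-- `τ_α ≠ 0`. [folklore] -/
theorem I_smul_pauli_ne_zero (α : Fin 3) : I • pauli α ≠ 0 := by
  intro h
  fin_cases α
  · have h01 := congr_fun (congr_fun h 0) 1
    simp [pauli] at h01
  · have h01 := congr_fun (congr_fun h 0) 1
    simp [pauli] at h01
  · have h00 := congr_fun (congr_fun h 0) 0
    simp [pauli] at h00

/-- A REAL multiple of `τ_α` is skew-Hermitian (`star` spelling). [folklore] -/
theorem star_ofReal_smul_I_smul_pauli (r : ℝ) (α : Fin 3) :
    star (((r : ℝ) : ℂ) • (I • pauli α)) = -(((r : ℝ) : ℂ) • (I • pauli α)) := by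
  rw [Matrix.star_eq_conjTranspose, Matrix.conjTranspose_smul, Complex.star_def, Complex.conj_ofReal,
    conjTranspose_I_smul_pauli, smul_neg]

/-- A real multiple of `τ_α` is traceless. [folklore] -/
theorem trace_ofReal_smul_I_smul_pauli (r : ℝ) (α : Fin 3) : (((r : ℝ) : ℂ) • (I • pauli α)).trace = 0 := by
  rw [Matrix.trace_smul, trace_I_smul_pauli, smul_zero]

/-- A real multiple of `τ_α` lies in `𝔰𝔲(2)` — the letter X-KNIT-L's `Y : PBond → lieSU (Fin 2)` wants. [folklore] -/
theorem ofReal_smul_I_smul_pauli_mem_lieSU (r : ℝ) (α : Fin 3) : ((r : ℝ) : ℂ) • (I • pauli α) ∈ lieSU (Fin 2) :=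
  mem_lieSU_iff.2 ⟨star_ofReal_smul_I_smul_pauli r α, trace_ofReal_smul_I_smul_pauli r α⟩

/-- `r • τ_α = 0 ↔ r = 0`. [folklore] -/
theorem ofReal_smul_I_smul_pauli_eq_zero_iff (r : ℝ) (α : Fin 3) : ((r : ℝ) : ℂ) • (I • pauli α) = 0 ↔ r = 0 := by
  rw [smul_eq_zero, Complex.ofReal_eq_zero, or_iff_left (I_smul_pauli_ne_zero α)]

section Frobenius

open scoped Matrix.Norms.Frobenius

/-- ★ **`‖τ_α‖_F = √2`** (Frobenius norm — the skeleton's `open scoped Matrix.Norms.Frobenius`; by entries). [folklore] -/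
theorem frobenius_norm_I_smul_pauli (α : Fin 3) : ‖I • pauli α‖ = Real.sqrt 2 := by
  rw [Matrix.frobenius_norm_def, Real.sqrt_eq_rpow]
  congr 1
  fin_cases α <;> simp [pauli, Fin.sum_univ_two] <;> norm_num

/-- `‖r • τ_α‖_F = |r|·√2`. [folklore] -/
theorem frobenius_norm_ofReal_smul_I_smul_pauli (r : ℝ) (α : Fin 3) :
    ‖((r : ℝ) : ℂ) • (I • pauli α)‖ = |r| * Real.sqrt 2 := by
  rw [norm_smul, Complex.norm_real, Real.norm_eq_abs, frobenius_norm_I_smul_pauli]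

/-- ★ `‖r • τ_α‖_F² = 2·r²` — the factor `2` of rows R5∕R6. [folklore] -/
theorem frobenius_norm_sq_ofReal_smul_I_smul_pauli (r : ℝ) (α : Fin 3) :
    ‖((r : ℝ) : ℂ) • (I • pauli α)‖ ^ 2 = 2 * r ^ 2 := by
  rw [frobenius_norm_ofReal_smul_I_smul_pauli, mul_pow, sq_abs, Real.sq_sqrt (by norm_num)]
  ring

end Frobenius

section Operator

open scoped Matrix.Norms.L2Operator

/-- Operator-norm reading (X-KNIT-L's scope): `‖r • τ_α‖ ≤ 2|r|` (crude, via ✓`norm_I_smul_pauli_le_two`). [folklore] -/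
theorem opNorm_ofReal_smul_I_smul_pauli_le (r : ℝ) (α : Fin 3) : ‖((r : ℝ) : ℂ) • (I • pauli α)‖ ≤ 2 * |r| := by
  rw [norm_smul, Complex.norm_real, Real.norm_eq_abs, mul_comm]
  exact mul_le_mul_of_nonneg_right (norm_I_smul_pauli_le_two α) (abs_nonneg r)

end Operator

end Pauli

/-! ## §2 Torus rows of the dressed field `u_α b := (u⁰ b : ℂ) • τ_α`, for ANY real bond function `u⁰` -/

section Torus

open scoped Matrix.Norms.Frobenius

variable {P : Params} {j : ℕ}

/-- **Row R2, pointwise**: every `u_α b` is skew-Hermitian and traceless — the skeleton's letter verbatim. [cite: Balaban1985UV3, p. 260] -/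
theorem dress_skew_traceless (u0 : PBond P j → ℝ) (α : Fin 3) (b : PBond P j) :
    star (((u0 b : ℝ) : ℂ) • (I • pauli α)) = -(((u0 b : ℝ) : ℂ) • (I • pauli α)) ∧
      (((u0 b : ℝ) : ℂ) • (I • pauli α)).trace = 0 :=
  ⟨star_ofReal_smul_I_smul_pauli _ α, trace_ofReal_smul_I_smul_pauli _ α⟩

/-- **Support transfer**: `u_α b ≠ 0 → u⁰ b ≠ 0`, so ANY support row of the scalar (T-push's, GLOBAL-LS's, px22's) is a support row of the dressing
in the same letters. [folklore] -/
theorem ne_zero_of_dress_ne_zero (u0 : PBond P j → ℝ) (α : Fin 3) (b : PBond P j)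
    (h : ((u0 b : ℝ) : ℂ) • (I • pauli α) ≠ 0) : u0 b ≠ 0 :=
  fun h0 => h (by rw [h0, Complex.ofReal_zero, zero_smul])

/-- ★ **The `slotBond` curl of the dressed field is the dressed scalar curl**: `(du_α)_p = ((du⁰)_p : ℂ) • τ_α`. [folklore] -/
theorem curl_dress (u0 : PBond P j → ℝ) (α : Fin 3) (p : Plaq P j) :
    ((u0 (slotBond p 0) : ℝ) : ℂ) • (I • pauli α) + ((u0 (slotBond p 1) : ℝ) : ℂ) • (I • pauli α) -
        ((u0 (slotBond p 2) : ℝ) : ℂ) • (I • pauli α) - ((u0 (slotBond p 3) : ℝ) : ℂ) • (I • pauli α) =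
      (((u0 (slotBond p 0) + u0 (slotBond p 1) - u0 (slotBond p 2) - u0 (slotBond p 3) : ℝ)) : ℂ) • (I • pauli α) := by
  push_cast
  simp only [add_smul, sub_smul]

/-- ★★ **Row R6 (mass), EXACT**: `Σ_b ‖u_α b‖_F² = 2·Σ_b (u⁰ b)²`. [folklore] -/
theorem sum_norm_sq_dress (u0 : PBond P j → ℝ) (α : Fin 3) :
    ∑ b : PBond P j, ‖((u0 b : ℝ) : ℂ) • (I • pauli α)‖ ^ 2 = 2 * ∑ b : PBond P j, u0 b ^ 2 := by
  rw [Finset.mul_sum]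
  exact Finset.sum_congr rfl fun b _ => frobenius_norm_sq_ofReal_smul_I_smul_pauli _ α

/-- ★★ **Row R5 (pinned curl energy), EXACT**: `Σ_p ‖(du_α)_p‖_F² = 2·Σ_p ((du⁰)_p)²` in the `slotBond` letters. [folklore] -/
theorem sum_norm_sq_curl_dress (u0 : PBond P j → ℝ) (α : Fin 3) :
    ∑ p : Plaq P j, ‖((u0 (slotBond p 0) : ℝ) : ℂ) • (I • pauli α) + ((u0 (slotBond p 1) : ℝ) : ℂ) • (I • pauli α) -
        ((u0 (slotBond p 2) : ℝ) : ℂ) • (I • pauli α) - ((u0 (slotBond p 3) : ℝ) : ℂ) • (I • pauli α)‖ ^ 2 =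
      2 * ∑ p : Plaq P j, (u0 (slotBond p 0) + u0 (slotBond p 1) - u0 (slotBond p 2) - u0 (slotBond p 3)) ^ 2 := by
  rw [Finset.mul_sum]
  refine Finset.sum_congr rfl fun p _ => ?_
  rw [curl_dress, frobenius_norm_sq_ofReal_smul_I_smul_pauli]

/-- **Flat-pairing reading**: `Re Tr((r • τ_α) X) = r · Re Tr(τ_α X)`. [folklore] -/
theorem re_trace_dress_mul (r : ℝ) (α : Fin 3) (X : Matrix (Fin 2) (Fin 2) ℂ) :
    ((((r : ℝ) : ℂ) • (I • pauli α)) * X).trace.re = r * ((I • pauli α) * X).trace.re := by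
  rw [Matrix.smul_mul, Matrix.trace_smul, smul_eq_mul, Complex.re_ofReal_mul]

/-- **Flat-pairing reading of the curl**: `Re Tr((du_α)_p · X) = (du⁰)_p · Re Tr(τ_α X)` — the summand of X-KNIT-L's flat pairing for the dressed
field is the scalar curl times the Pauli trace (✓`UnitScaleGibbsLinProxyFluxIdentification.sum_mul_re_trace_eq_re_trace_sum`'s letter).
[cite: GrossCMP1983, Thm 2.2] -/
theorem re_trace_curl_dress_mul (u0 : PBond P j → ℝ) (α : Fin 3) (p : Plaq P j) (X : Matrix (Fin 2) (Fin 2) ℂ) :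
    ((((u0 (slotBond p 0) : ℝ) : ℂ) • (I • pauli α) + ((u0 (slotBond p 1) : ℝ) : ℂ) • (I • pauli α) -
        ((u0 (slotBond p 2) : ℝ) : ℂ) • (I • pauli α) - ((u0 (slotBond p 3) : ℝ) : ℂ) • (I • pauli α)) * X).trace.re =
      (u0 (slotBond p 0) + u0 (slotBond p 1) - u0 (slotBond p 2) - u0 (slotBond p 3)) * ((I • pauli α) * X).trace.re := by
  rw [curl_dress, re_trace_dress_mul]

/-- **The sum form**: `Σ_p Re Tr((du_α)_p X_p) = Σ_p (du⁰)_p · Re Tr(τ_α X_p)`. [cite: GrossCMP1983, Thm 2.2] -/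
theorem sum_re_trace_curl_dress_mul (u0 : PBond P j → ℝ) (α : Fin 3) (X : Plaq P j → Matrix (Fin 2) (Fin 2) ℂ) :
    ∑ p : Plaq P j, ((((u0 (slotBond p 0) : ℝ) : ℂ) • (I • pauli α) + ((u0 (slotBond p 1) : ℝ) : ℂ) • (I • pauli α) -
        ((u0 (slotBond p 2) : ℝ) : ℂ) • (I • pauli α) - ((u0 (slotBond p 3) : ℝ) : ℂ) • (I • pauli α)) * X p).trace.re =
      ∑ p : Plaq P j, (u0 (slotBond p 0) + u0 (slotBond p 1) - u0 (slotBond p 2) - u0 (slotBond p 3)) *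
        ((I • pauli α) * X p).trace.re :=
  Finset.sum_congr rfl fun p _ => re_trace_curl_dress_mul u0 α p (X p)

end Torus

end Summit.QuantumFields.YangMills.Theorems.UnitScaleGibbsTestFieldSU2Dressing

end
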